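import Literature.MathematicalPhysics.QuantumFieldTheory.Balaban1983to89.B9Eq342GreenPrimeTowerSupBoundDecayPenalty
import Literature.MathematicalPhysics.QuantumFieldTheory.Balaban1983to89.B9Eq349ConjugatedGreenBlockDecayTower

/-!
# `Balaban1983to89.B9Eq342GreenPrimeTowerSupBoundDecayClosed` — T. Bałaban, *Propagators for lattice gauge theories in a background field*, Commun. Math.
# Phys. **99** (1985) 389–434 [Balaban1985BackgroundPropagators] Thm 3.1 (3.42) p. 397, FIRST ENTRY, FOR PRINT's `k`-LEVEL SITE PROPAGATOR `G′_k(U)`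
# (`B9Eq324DeltaPrimeATower.GpOfUk`): **STOREY (D) CLOSED AT THE TOWER — `∃ α₁ C ρ κ′` BEFORE the height `n`, the volume `m` and the background:
# on print's diagonal window (`ηL^{n+1} = 1`, `c₀(L^{n+1})^d = c₁`, unitary `U` with `‖U(b) − 1‖ ≤ αη`, `α ≤ α₁`, level averages `‖Ū^j(b) − 1‖ ≤ ε_j ≤ αr^j`)
# `‖(G′_k(U)f)(x₀)‖ ≤ B·sup|f|` for EVERY `f`, `B = B(d, a′, C, κ′)` a DISPLAYED CLOSED FORM (`Σ_{l<d}`, `K_d`, `2e^{1∕2}`, `√(3^d2^d)`) — EVERY ANALYTIC LETTER OF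
# THE ROW INHABITED BY A NAMED FILE: (T) this lineage, (D-P)k + masses ne9-leaf-03's `B9Eq324PenaltyBlockLocal`, (W) + rates this lineage, (D-FS)
# ne9-leaf-02's `B5Eq129FreeResolventDecayedLetterSiteDiag`, (D-E)k ne9-leaf-03 g74's `B9Eq349ConjugatedGreenBlockDecayTower.exists_block_decay_GpOfUk`;
# the constant a function of `(d, L, a′, M_φM_φ′, r)` through `(α₁, C, ρ)` only** — the tower twin of `B9Eq342GreenPrimeSupBoundDecayClosed` (storey (D)
# of the NE9 owner's sup-norm programme, plan v10 §5; `t4/b2b-balaban-t4-ne9-p1/g91/TOWER-ROW-ASSEMBLY.md`)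

statement-level skeleton of published theorems with citation tags; proofs where landed; nothing here is a claim about the Yang–Mills mass gap

CITATION HEADER (lean-in-tree rule).  Audit cell `pub-balaban`, sub-cell `t4`, BINDER row NE9; filed by the NE9 BINDER-row OWNER lineage
`b2b-balaban-t4-ne9-p1` (gen 91).  Composed BY NAME: this lineage's `B9Eq342GreenPrimeTowerSupBoundDecayPenalty.norm_GpOfUk_apply_le_rowSum_heightFree_penalty_unitary`
(the height-free tower row, (D-E)k displayed) with ne9-leaf-03 g74's `B9Eq349ConjugatedGreenBlockDecayTower.exists_block_decay_GpOfUk` ((D-E)k: `∃ α₁ C ρ`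
before the height).  Sources READ first-hand (`paper:balaban1985-cmp99-background-propagators`): p. 397 Thm 3.1 (3.42) «B₀, δ₀ dependent on d and L only»,
p. 396 (3.35)–(3.37) (the window), p. 394 (3.24)–(3.25).  NOTHING of the random-walk proof (pp. 415–426) reproduced: this is the cell's energy∕positivity road.

WHAT IS PROVED (sorry-free; proof lane — no `def`; [folklore] one composition).
* **`exists_supNorm_bound_GpOfUk`**: `∃ α₁ C ρ κ′` (`0 < α₁`, `0 ≤ C`, `0 < ρ`, `0 < κ′ ≤ ρ`, `2κ′ < 1∕√(4d+1)`) such that for every height `n`, `η` with `ηL^{n+1} = 1`, weights `c₀(L^{n+1})^d = c₁`,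
  every period `m`, every background of the window with mutually adjoint, unitary transporters (`hRS`, `star U(b) = U(b)⁻¹`, `U(b) ∈ U1`) and contractive
  level-average transporters (`hRlev`), ANY positivity witness `hpos′`, every big-block family `P` and every `f` with `‖f(x)‖ ≤ F`:
  `‖(G′_k(U)f)(x₀)‖ ≤ B·F` with THE DISPLAYED CLOSED FORM `B = ((1 + |a′|C)·2e^{1∕2}·Σ_{l<d}2^{l+1} + √(3^d2^d)·√(2e^{1∕2}K_d(1∕√(4d+1) − 2κ′))·C)·K_d(κ′)`
  (`κ′ = min(ρ, √(1∕(4d+1))∕4)`; `(α₁, C, ρ)` the (D-E)k triple).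
HONEST SCOPE.  VALUE row only (no ∇-row, no Hölder rows (3.40), no (3.43)–(3.47)); the compatibility of the fibre norm with a `*`-trace, `hRS`, `U1`-membership
and `hRlev` are the chain's standing STRUCTURAL letters (displayed); the positivity `hpos′` is any witness (on the window it is ne9-leaf-03 g64's); «NE9 ⇐ the
named binders»; NE9 NOT PRINTED ∕ NOT PROVED; row WALLED ON A MODEL (O-NE9-1; NEEDS-COORDINATOR #5 UNRULED); spine PROVED 0∕9; rung (B)+1 on a finite T⁴ — NOT
infinite volume, NOT mass gap, NOT BetaPertH, NOT Clay.  HONEST DEPENDENCY: continuum YM on T⁴ ⇐ BetaPertH ∧ nine spine estimates (0/9 proved); BetaPertH ⇐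
(D1) ∧ (D4) ∧ CAP+tail; G-an2-4 gates asym, D1 and NE2/3/4.  NEW file; nothing modified.  Net new unproved facts: 0.
-/

noncomputable section

open scoped InnerProductSpace ComplexConjugate BigOperators

namespace Literature.MathematicalPhysics.QuantumFieldTheory.Balaban1983to89.B9Eq342GreenPrimeTowerSupBoundDecayClosed

open B4Sect5Torus (TSite tdist)
open B4Sect5Proof (latticeConst latticeConst_nonneg)
open B7Prop1Explicit (U1)
open B9SectCLatticeCarrier (Bond)
open B9Eq311L2Pairing (WL2)
open B11Eq103H1Complex (SiteL2K)
open B9Eq310HessianOperator (adTransportW)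
open B9Eq319QprimeTorus (fineP blockCoord)
open B9Eq315QTower (towerP UlevOf)
open B9Eq316TowerFlatIsOneStep (towerP_eq_fineP_pow siteCast)
open B9Eq324DeltaPrimeATower (laplacePrimeAk GpOfUk)
open B9Eq342GreenPrimeTowerSupBoundDecayPenalty (norm_GpOfUk_apply_le_rowSum_heightFree_penalty_unitary)
open B9Eq349ConjugatedGreenBlockDecayTower (exists_block_decay_GpOfUk)

variable {d : ℕ} (L : ℕ) [NeZero L] {𝔸 : Type*} [NormedRing 𝔸] [NormedAlgebra ℂ 𝔸] [CompleteSpace 𝔸] [NormOneClass 𝔸] [StarRing 𝔸]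
  {W : Type*} [NormedAddCommGroup W] [InnerProductSpace ℂ W] [FiniteDimensional ℂ W] (φ : W ≃ₗ[ℂ] 𝔸) {a' Mφ Mφ' : ℝ}
  (hMφ : 0 ≤ Mφ) (hMφ' : 0 ≤ Mφ') (hφn : ∀ w, ‖φ w‖ ≤ Mφ * ‖w‖) (hφn' : ∀ X, ‖φ.symm X‖ ≤ Mφ' * ‖X‖) (ha' : 0 < a')
  {r : ℝ} (hr0 : 0 ≤ r) (hr1 : r < 1)
  (τ : 𝔸 →ₗ[ℂ] ℂ) (hτ₂ : ∀ X Y : 𝔸, τ (X * Y) = τ (Y * X)) (hφτ : ∀ X Y : 𝔸, ⟪φ.symm X, φ.symm Y⟫_ℂ = τ (star X * Y))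

include hMφ hMφ' hφn hφn' ha' hr0 hr1 hτ₂ hφτ in
/-- **STOREY (D) CLOSED AT THE TOWER: `∃ α₁ C ρ κ′` BEFORE THE HEIGHT, `‖(G′_k(U)f)(x₀)‖ ≤ B(d, a′, C, κ′)·sup|f|` FOR EVERY `f` ON PRINT's DIAGONAL WINDOW** (`1 ≤ d`;
`L`, `M_φM_φ′`, `a′ > 0`, the profile ratio `r ∈ [0,1[`, a `*`-trace compatible with the fibre norm given): at every height `n`, `ηL^{n+1} = 1`, `c₀(L^{n+1})^d = c₁`,
every period `m`, every background with `hRS`, `U(b) ∈ U1`, `star U(b) = U(b)⁻¹`, `‖U(b) − 1‖ ≤ αη` (`α ≤ α₁`), level averages `‖Ū^j(b) − 1‖ ≤ ε_j ≤ αr^j` in `U1`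
with contractive transporters (`hRlev`), ANY `hpos′`, every big-block family `P`, every `x₀` and `f`: `‖(G′_k(U)f)(x₀)‖ ≤ B·F` whenever `‖f(x)‖ ≤ F` — the `L^∞ → L^∞`
bound of print's `G′_k(U)`, uniform in the height, the volume and the background: `norm_GpOfUk_apply_le_rowSum_heightFree_penalty_unitary` at `k := d` with its
(D-E)k letter inhabited by ne9-leaf-03 g74's `exists_block_decay_GpOfUk` (`C_E := C`, `κ := ρ`) and `κ′ := min(ρ, √(1∕(4d+1))∕4)`.
[cite: Balaban1985BackgroundPropagators, Thm 3.1 (3.42) p.397, (3.35)–(3.37) p.396, (3.24)–(3.25) p.394, (3.49) p.399] -/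
theorem exists_supNorm_bound_GpOfUk (hd : 1 ≤ d) :
    ∃ α₁ C ρ κ' : ℝ, 0 < α₁ ∧ 0 ≤ C ∧ 0 < ρ ∧ 0 < κ' ∧ κ' ≤ ρ ∧ 2 * κ' < Real.sqrt (1 / (4 * d + 1)) ∧
      ∀ (n : ℕ) (η : ℝ), η * (L : ℝ) ^ (n + 1) = 1 →
      ∀ (c₀ c₁ : ℝ) [Fact (0 < c₀)] [Fact (0 < c₁)], c₀ * ((L : ℝ) ^ (n + 1)) ^ d = c₁ →
      ∀ (m : Fin d → ℕ) [∀ i, NeZero (m i)] (U : Bond d (towerP L m (n + 1)) → 𝔸ˣ),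
        (∀ (b : Bond d (towerP L m (n + 1))) (v u : W), ⟪adTransportW φ U b v, u⟫_ℂ = ⟪v, adTransportW φ (fun b => (U b)⁻¹) b u⟫_ℂ) →
      ∀ (α : ℝ), 0 ≤ α → α ≤ α₁ → (∀ b, U b ∈ U1 𝔸) → (∀ b, ‖(U b : 𝔸) - 1‖ ≤ α * η) →
      ∀ (εU : ℕ → ℝ), (∀ j, 0 ≤ εU j) → (∀ j < n + 1, εU j ≤ α * r ^ j) →
        (∀ (j : ℕ) (b : Bond d (towerP L m (j + 1))), ‖(UlevOf L m (n + 1) U j b : 𝔸) - 1‖ ≤ εU j) →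
        (∀ (j : ℕ) (b : Bond d (towerP L m (j + 1))), UlevOf L m (n + 1) U j b ∈ U1 𝔸) →
        (∀ b, star (U b : 𝔸) = ((U b)⁻¹ : 𝔸ˣ)) →
        (∀ (j : ℕ) (b : Bond d (towerP L m (j + 1))) (w : W), ‖adTransportW φ (UlevOf L m (n + 1) U j) b w‖ ≤ ‖w‖) →
      ∀ (hpos' : ∀ x : SiteL2K ℂ d (towerP L m (n + 1)) c₀ W, x ≠ 0 → 0 < RCLike.re ⟪x, laplacePrimeAk L m n φ η U a' (c₁ := c₁) x⟫_ℂ)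
        (PS : TSite d m → SiteL2K ℂ d (towerP L m (n + 1)) c₀ W →L[ℂ] SiteL2K ℂ d (towerP L m (n + 1)) c₀ W),
        (∀ (y : TSite d m) (f : SiteL2K ℂ d (towerP L m (n + 1)) c₀ W) (x : TSite d (towerP L m (n + 1))),
          WL2.equiv ℂ (fun _ : TSite d (towerP L m (n + 1)) => c₀) W (PS y f) x =
            if blockCoord (L ^ (n + 1)) m (siteCast (towerP_eq_fineP_pow L m (n + 1)) x) = y then
              WL2.equiv ℂ (fun _ : TSite d (towerP L m (n + 1)) => c₀) W f x else 0) →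
      ∀ (x₀ : TSite d (towerP L m (n + 1))) (f : SiteL2K ℂ d (towerP L m (n + 1)) c₀ W) (F : ℝ),
        (∀ y, ‖WL2.equiv ℂ (fun _ : TSite d (towerP L m (n + 1)) => c₀) W f y‖ ≤ F) →
        ‖WL2.equiv ℂ (fun _ : TSite d (towerP L m (n + 1)) => c₀) W (GpOfUk L m n φ η U a' (c₁ := c₁) hpos' f) x₀‖ ≤
          ((1 + |a'| * C) * (Real.exp (1 / 2) * 2) * (∑ l ∈ Finset.range d, (2 : ℝ) ^ (l + 1)) +
            Real.sqrt (3 ^ d * 2 ^ d) * Real.sqrt ((Real.exp (1 / 2) * 2) * latticeConst d (Real.sqrt (1 / (4 * d + 1)) - 2 * κ')) * C) *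
          latticeConst d κ' * F := by
  obtain ⟨α₁, C, ρ, hα₁, hC, hρ, hdecAll⟩ := exists_block_decay_GpOfUk L φ (a' := a') hMφ hMφ' hφn hφn' ha' hr0 hr1
  have hs0 : 0 < Real.sqrt (1 / (4 * (d : ℝ) + 1)) := Real.sqrt_pos.2 (by positivity)
  have hκ'0 : 0 < min ρ (Real.sqrt (1 / (4 * d + 1)) / 4) := lt_min hρ (by positivity)
  have hκ'ρ : min ρ (Real.sqrt (1 / (4 * d + 1)) / 4) ≤ ρ := min_le_left _ _
  have h2κ : 2 * min ρ (Real.sqrt (1 / (4 * d + 1)) / 4) < Real.sqrt (1 / (4 * d + 1)) := by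
    have h1 : min ρ (Real.sqrt (1 / (4 * d + 1)) / 4) ≤ Real.sqrt (1 / (4 * d + 1)) / 4 := min_le_right _ _
    linarith
  refine ⟨α₁, C, ρ, min ρ (Real.sqrt (1 / (4 * d + 1)) / 4), hα₁, hC, hρ, hκ'0, hκ'ρ, h2κ, ?_⟩
  intro n η hηL c₀ c₁ _ _ hdiag m _ U hRS α hα hαle hUb hUε εU hεU hεg hLε hLb hUstar hRlev hpos' PS hPS x₀ f F hF
  have hm : ∀ i, 1 ≤ m i := fun i => Nat.one_le_iff_ne_zero.mpr (NeZero.ne (m i))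
  have hηN : η⁻¹ = (L : ℝ) ^ (n + 1) := inv_eq_of_mul_eq_one_right hηL
  have hdec : ∀ v y : TSite d m, ‖PS y ∘L LinearMap.toContinuousLinearMap (GpOfUk L m n φ η U a' (c₁ := c₁) hpos') ∘L PS v‖ ≤
      C * Real.exp (-(ρ * tdist m v y)) := fun v y =>
    hdecAll n η hηL c₀ c₁ hdiag m hm U hRS α hα hαle hUb hUε εU hεU hεg hLε hLb hpos' PS hPS v y
  exact norm_GpOfUk_apply_le_rowSum_heightFree_penalty_unitary L m n φ η U a' hpos' (c₁ := c₁) hd τ hτ₂ hUstar hφτ hRlev hPS hC hκ'0 hκ'ρ h2κ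
    hηN hdiag (le_refl d) hdec x₀ f hF

end Literature.MathematicalPhysics.QuantumFieldTheory.Balaban1983to89.B9Eq342GreenPrimeTowerSupBoundDecayClosed

end
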